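import Mathlib
import Summits.Ventures.PercRepro2.Defs
import Summits.Ventures.PercRepro2.Harris
import Summits.Ventures.PercRepro2.Graph
import Summits.Ventures.PercRepro2.Induced
import Summits.Ventures.PercRepro2.VdBKahn
import Summits.Ventures.PercRepro2.NestIID
import Summits.Ventures.PercRepro2.MixedCoreForbidDefs
import Summits.Ventures.PercRepro2.MixedNestIID

/-!
# The mixed nested core-forbidden sum is nonnegative (Theorem 3, row `MixedCoreForbidRow`)
(blind cell PercRepro2, mine-1 g11)

`mixedCoreForbidIID X Y u = Σ w w' 1_{R_X}(ω) 1_{R_Y}(ω') (1 − 1[u∈C] 1[u∈C']) σ_x σ_y ≥ 0` for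
`X ⊆ Y`, `u ∉ Y`: the three-nest identity `mixedCoreForbidIID_eq_nest` turns it into
`MixedNestIID.nestIID_insert_le_add`. The row `MixedCoreForbidRow` of `MixedCoreForbidDefs` holds
(its distinctness hypotheses are not needed).
-/

namespace Summit.Ventures.PercRepro2

section MixedCoreForbidIID

variable {V : Type*} {E : Type*} [Fintype E] [DecidableEq E] [Fintype V] [DecidableEq V]
  {R : Type*} [CommRing R] [LinearOrder R] [IsStrictOrderedRing R]

variable (p : E → R) (ends : E → Sym2 V) (s : V)

/-- **Theorem 3**: the mixed nested core-forbidden two-copy sum is nonnegative. -/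
theorem mixedCoreForbidIID_nonneg (hp : IsProbVec p) (x y : V) {X Y : Finset V} (u : V)
    (hXY : X ⊆ Y) (huY : u ∉ Y) : 0 ≤ mixedCoreForbidIID p ends s x y X Y u := by
  rw [mixedCoreForbidIID_eq_nest]
  have h := nestIID_insert_le_add p ends s hp x y u hXY huY
  linarith

/-- Row `MixedCoreForbidRow` holds for every probability vector. -/
theorem mixedCoreForbidRow_holds (hp : IsProbVec p) (x y : V) :
    MixedCoreForbidRow p ends s x y :=
  fun _ _ u hXY huY _ _ _ => mixedCoreForbidIID_nonneg p ends s hp x y u hXY huY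

end MixedCoreForbidIID

end Summit.Ventures.PercRepro2
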